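import Literature.MathematicalPhysics.QuantumFieldTheory.Balaban1983to89.B9SmoothHolderClassSliceSNDict

/-!
# `Balaban1983to89.B9SmoothHolderClassSliceSN` — T. Bałaban, *Propagators for lattice gauge theories in a background field*, Commun. Math. Phys. **99** (1985) 389–434
# [Balaban1985BackgroundPropagators], (3.44)–(3.45) p. 398 (the Hölder INPUT `‖λ‖_{β+ε} + |λ|` of `∇_UG′(U)∇\*_Uλ`): the DIRECTION SLICES `A ↦ A_μ(·)` carry dag-n06-l's print-weighted
# transported BOND class `bHZKP (taxiB U) s` INTO the print-weighted transported SITE class `bHZP (taxiS U) s` — the Hölder-SOURCE sector comparison (brick B1 of the `h44G ∕ hp45W` road)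

[4] = T. Bałaban, *Propagators and renormalization transformations for lattice gauge theories. II*, Commun. Math. Phys. **96** (1984) 223–250 [`Balaban1984PropagatorsII`].
statement-level skeleton of published theorems with citation tags; proofs where landed; nothing here is a claim about the Yang–Mills mass gap.

THE PRINT.  p. 391 «A_μ(x) = A(x, x + ηe_μ)»; (3.40) p. 397 (the transported quotient over `|x − x′| ≦ 1`); (3.44)–(3.45) p. 398; [4] (2.2) p. 224 (the bands `Λ_j`), (2.51)–(2.54) pp. 232–233,
(2.137) p. 247 (admissible pairs).

WHY THIS FILE (cell `pub-ymgap`, node N06 [B9], seat `pub-ymgap-dag-n06-c` g19; road memo `pub-ymgap-dag-n06-c/HPDGW-ROAD.md`, brick B1).  The certificate's (3.44)/(3.45) binders `h44G ∕ hp45W`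
read `∇_UG′∇\*_U` with SOURCE the bond class `bXH x U = bHZKPG (taxiB U) wX` (`hbXH`); n06-k's input engine (`B9RWSums344InputPairDir.inputPair3445_of_local37_dir`) works on the
direction-packed SITE carrier, fed by def-Y's `∇\*_U = c_fη·Σ_μ DscoS ∘ dirSliceK μ ν` (`Node00.OpsYNablaBridge`).  So the source must be SLICED: THIS FILE bounds `dirSliceK μ ν` from
`bHZKP (taxiB U) s` into `bHZP (taxiS U) s` (same exponent).  Dictionary: a slice's assembled `μ′`-slot value at `chart x` IS `A`'s assembled `ν`-slot value at the bond `⟨x, μ⟩`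
(`assembleK_dirSliceK`), the site table `taxiS` at charted points IS the bond table `taxiB` (both `parTaxiV` on base points), the site weight `wEta` IS the bond weight `wEtaK`
(`supDist = |·|_T` on the chart); the one genuine point: the site class ranges over NEAR site pairs (`|z − z′|_T ≤ L^{j(z)}`, one-sided) while the bond class ranges over ADMISSIBLE pairs
((2.137): the bound at BOTH base points) — a near, non-admissible pair has `j(z′) = j(z) − 1` exactly (levels of near sites differ by ≤ 1, [4] (2.2) in the torus distance, `sepT`),
its weight is `≤ L^{2s}·(Lʲη)^{−s}` at the localisation block and its difference is read through the SUP channel (`2c_bb_b·sup|A|`); an admissible pair whose first point lies off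
`Δ̃(y′)` is read through the REVERSED pair (unitary transport, `c_bb_b`).  Kernel: `C·e^{δr}·e^{−δd(y,y′)}` with the LAYER-B radius.
Geometry and dictionary: the prequel `B9SmoothHolderClassSliceSNDict` (§1).
* §2 ★★★ `hasMaj_dirSliceK_bHZKP_bHZP` — `HasMaj (bHZKP (taxiB U) s) (bHZP (taxiS U) s) (dirSliceK μ ν) (C_σ·e^{δr}·e^{−δd})`, `C_σ` closed in `L, c_b, b_b`.
HONEST SCOPE.  Class bookkeeping; no estimate of [B9] asserted; COUNT-NEUTRAL; N06 NOT discharged; nothing continuum, nothing about the mass gap.  Cell `pub-ymgap` (HUMAN RULING D-0062),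
Track A node N06 [B9], seat `pub-ymgap-dag-n06-c` (g19), 2026-08-29; a NEW file; 0 `def`, no `sorry`, no `axiom`, no `instance`, no `notation`.
-/

noncomputable section

namespace Literature.MathematicalPhysics.QuantumFieldTheory.Balaban1983to89.B9SmoothHolderClassSliceSN

open B4Reflection242 (boxDom)
open B4TorusKernel.MultiPeriod (torusSupNorm torusSupNorm_nonneg)
open B6GlobalChartV1 (PV blkV1)
open B6Geom246MultiLevelTorus (geomT torusSupNorm_neg)
open B6Ineq2142KLevelV1 (β lvl)
open B6KLevelCensusIndexV1 (KIdx Adm)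
open B6MultiLevelBoxOperator (N0 bigSide one_le_bigSide)
open B6MultiLevelTorusOperator (one_le_of_mem)
open B6Prop22KLevelTorusCensusEta (nKT nKT_pos)
open B9GeoNormsKLevelV1 (geo9K)
open B9GeoLemma21KLevelV1 (geo9K_dist_triangle geo9K_len_pos geo9K_dist_comm)
open B9Thm34Ext (toB6)
open B11SectG (BlockNorm HasMaj)
open B11SectGGlobal (Size)
open B11SectGGlobalSizes
open B11SectGSmoothCutT (Size.ofPairsT ofPairsT_sz_le ofPairsT_term_le)
open B9Eq39Adjoint (R)
open B9Thm39ReadingCoords (coordBound39 basisBound39 abs_repr_le)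
open B9CoReadingCoords (assembleK XBK)
open B9CoReadingCoordsS (XSK sIK)
open B9MultiscaleSmoothPartitionY (scl scl_pos NearY levY_window_of_nearY)
open B9MultiscaleSmoothPartitionYNear (rNear dist_sIK_le_of_nearY)
open B9SmoothHolderClassS (NearPair wEta wEta_nonneg Wscl Wscl_nonneg scl_div_nKT_pos_le_one one_le_Wscl)
open B9SmoothHolderClassK (srcY NearPairK wEtaK wEtaK_nonneg)
open B9SmoothHolderClassT (trDif trDif_apply)
open B9SmoothHolderClassTClosure (len_rpow_neg_eq_Wscl len_le_one len_eq_scl_div)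
open B9SmoothHolderClassP (bHZP bHZP_loc bHZKP bHZKP_loc bHZKP_isLoc_iff)
open B9SmoothHolderClassTGradientTools (lvl_sIK_eq_levY)
open B9GradViaDivLettersSmoothTerms (blkV1_level_eq_levY Wscl_le_of_lvl_le)
open B9GradViaDivLettersTransported (taxiS taxiB)
open B9GradViaDivLettersAtPinsHolderPairs (sIK_chartY)
open B9CoReadingCoordsHolderSNear (NearS)
open B9Eq340ProbeBridgeSNtoKA (supDist_eq_torusSupNorm)
open Node00 (SiteY FBondY IBondY CfgY toKT levY)
open Node00.OpsYNablaBridge (chartY dirSliceK dirSliceK_apply assembleK_dirSliceK bondCompY)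
open LatticeFieldCalculus (supDist)
open B6GlobalChartV1 (boxEquiv)
open T4RelativeLadder (UnitaryLike)
open Node00.OpsYSectDCoords (repr_assembleK)
open B9Thm33G0ProbeZeroAtPinsAdm (norm_assembleK_le unitaryLike_parTaxiV)
open B9Eq340TaxiTelescope (norm_R_le)

variable {d ℓ : ℕ} {hd : 1 ≤ d + 1} {hL : Odd (ℓ + 1) ∧ 1 < ℓ + 1} {b₀ b₁ : ℝ}
variable {𝔸 : Type} [NormedRing 𝔸] [NormedAlgebra ℂ 𝔸] [CompleteSpace 𝔸]
variable {κ : Type} [Fintype κ]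
variable (i : KIdx d ℓ hd hL b₀ b₁)

open B9SmoothHolderClassSliceSNDict (levY_window_of_nearS trDif_dirSliceK wEta_chartY_eq_wEtaK nearPairK_of_adm len_le_of_lvl_le rpow_le_of_le_mul wEtaK_le_of_lt)

/-! ## §2 ★★★ The slice operator from the bond class into the site class -/

section Main

variable [Fintype (geo9K i).Site] (b : Module.Basis κ ℝ 𝔸) {B : B9.Backgrounds} (cfg : B.Cfg → CfgY 𝔸 i) (U₁ : B.Cfg)
variable {R₀ : ℝ} {H₀ : Prop} {bI : FBondY i → IBondY i}

/-- ★★★ **THE HÖLDER-SOURCE SECTOR COMPARISON.**  For unitary-like bond variables, a `1`-faithful bond block map `bI` (geometry only: the LAYER-B radius), print's units and `0 < s < 1`: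
the direction slice `dirSliceK μ ν` is bounded from dag-n06-l's print-weighted transported BOND class along `taxiB U` INTO the print-weighted transported SITE class along `taxiS U`,
same exponent, with majorant `C_σ·e^{δ r_σ}·e^{−δ d(y,y′)}`, `C_σ = L³·(2 + 2c_bb_b L²)`, `r_σ = 2(r_near + 1) + ((d+1)(L+1) + 2)`.  Sup channel: the slice's values are values of `A`
(`A = 0` off `Δ̃(y′)`); pair channel: admissible pairs are the bond class's pairs (first point in `Δ̃(y′)`: directly; else the reversed pair, unitary transport), non-admissible near
pairs have `j(x′) = j(x) − 1` and go through the sup channel with weight `≤ L²·(Lʲ′η)^{−s}`; blocks one `Δ̃`-step and one near-step apart differ by ≤ 3 levels and `≤ r_σ` in `d`.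
[cite: Balaban1985BackgroundPropagators, (3.40) p.397 + (3.44)–(3.45) p.398 + p.391; Balaban1984PropagatorsII, (2.2) p.224, (2.51)–(2.54) pp.232–233, (2.137) p.247] -/
theorem hasMaj_dirSliceK_bHZKP_bHZP [NormOneClass 𝔸] [FiniteDimensional ℝ 𝔸] (hU : ∀ μ' t, UnitaryLike (cfg U₁ μ' t))
    (hβ1 : ∀ f : FBondY i, (geomT i.D).dist (β i.hN i.D i.hk (bI f)) (blkV1 i.hN i.D f) ≤ 1) (hcf : |i.cf| = (nKT (toKT i) : ℝ))
    {s : ℝ} (hs0 : 0 < s) (hs1 : s < 1) {δ : ℝ} (hδ : 0 ≤ δ) (μ ν : Fin (d + 1)) :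
    HasMaj (bHZKP (κ := κ) i b (taxiB i B cfg U₁) (R := R₀) (H := H₀) hs0.le hs1.le)
      (bHZP (κ := κ) i b (taxiS i B cfg U₁) (R := R₀) (H := H₀) hs0.le hs1.le) (dirSliceK i μ ν)
      (fun y y' => ((((ℓ + 1 : ℕ) : ℝ)) ^ 3 * (2 + 2 * coordBound39 b * basisBound39 b * (((ℓ + 1 : ℕ) : ℝ)) ^ 2)) *
        Real.exp (δ * (2 * (rNear d ℓ + 1) + (((d : ℝ) + 1) * (((ℓ : ℝ) + 1) + 1) + 2))) * Real.exp (-(δ * (geo9K i).dist y y'))) := by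
  classical
  haveI : Nonempty (Fin (PV d ℓ i.m i.K hd hL).d) := ⟨⟨0, Nat.succ_pos d⟩⟩
  intro y' A hA y
  rw [bHZP_loc]
  rw [bHZKP_isLoc_iff] at hA
  set L : ℝ := ((ℓ + 1 : ℕ) : ℝ) with hLdef
  have hL1 : (1 : ℝ) ≤ L := by rw [hLdef]; exact_mod_cast Nat.succ_le_succ (Nat.zero_le ℓ)
  have hL0 : 0 ≤ L := zero_le_one.trans hL1
  set rσ : ℝ := 2 * (rNear d ℓ + 1) + (((d : ℝ) + 1) * (((ℓ : ℝ) + 1) + 1) + 2) with hrσ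
  set E : ℝ := Real.exp (δ * rσ) * Real.exp (-(δ * (geo9K i).dist y y')) with hE
  have hE0 : 0 ≤ E := by positivity
  have hE1 : (geo9K i).dist y y' ≤ rσ → 1 ≤ E := by
    intro hd
    rw [hE, ← Real.exp_add, ← Real.exp_zero]
    exact Real.exp_le_exp.2 (by nlinarith)
  have hcb : 0 ≤ coordBound39 b := by unfold coordBound39; exact norm_nonneg _
  have hbb : 0 ≤ basisBound39 b := Finset.sum_nonneg fun _ _ => norm_nonneg _
  have hR0 : ∀ g : 𝔸ˣ, R g (0 : 𝔸) = 0 := fun g => by rw [B9Eq39Adjoint.R_def, mul_zero, zero_mul]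
  -- the source: its two channels and their sizes
  set locA : ℝ := (bHZKP (κ := κ) i b (taxiB i B cfg U₁) (R := R₀) (H := H₀) hs0.le hs1.le).loc y' A with hlocA
  set SupA : ℝ := (Size.ofSup (toB6 (geo9K i) R₀ H₀) (fun (q : XBK κ i) (y : IBondY i) => NearY i y (srcY i q))).sz y' A with hSupA
  set PairA : ℝ := (Size.ofPairsT (toB6 (geo9K i) R₀ H₀) (fun (q : XBK κ i) (y : IBondY i) => NearY i y (srcY i q)) (NearPairK i) (wEtaK i s)
    (wEtaK_nonneg i s) (trDif b (taxiB i B cfg U₁))).sz y' A with hPairA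
  have hSupA0 : 0 ≤ SupA := Size.nonneg _ _ _
  have hPairA0 : 0 ≤ PairA := Size.nonneg _ _ _
  have hlocA_eq : locA = Wscl i (1 - s) y' * (Wscl i s y' * SupA + PairA) := by rw [hlocA, bHZKP_loc]
  have hy' : 0 < (geo9K i).len y' := geo9K_len_pos i y'
  have hy : 0 < (geo9K i).len y := geo9K_len_pos i y
  have hW1' : Wscl i (1 - s) y' = (geo9K i).len y' ^ (s - 1) := by rw [← len_rpow_neg_eq_Wscl i hcf, neg_sub]
  have hWs' : Wscl i s y' = (geo9K i).len y' ^ (-s) := by rw [← len_rpow_neg_eq_Wscl i hcf]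
  have hW1 : Wscl i (1 - s) y = (geo9K i).len y ^ (s - 1) := by rw [← len_rpow_neg_eq_Wscl i hcf, neg_sub]
  have hWs : Wscl i s y = (geo9K i).len y ^ (-s) := by rw [← len_rpow_neg_eq_Wscl i hcf]
  have hW1'inv : (Wscl i (1 - s) y')⁻¹ = (geo9K i).len y' ^ (1 - s) := by rw [hW1', ← Real.rpow_neg hy'.le, neg_sub]
  have hW1inv : (Wscl i (1 - s) y)⁻¹ = (geo9K i).len y ^ (1 - s) := by rw [hW1, ← Real.rpow_neg hy.le, neg_sub]
  have hW1'pos : 0 < Wscl i (1 - s) y' := lt_of_lt_of_le zero_lt_one (one_le_Wscl i (by linarith) y')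
  have hWs'0 : 0 ≤ Wscl i s y' := Wscl_nonneg i _ _
  have hSupA_le : SupA ≤ (geo9K i).len y' * locA := by
    -- `(Lʲ′η)⁻¹·SupA ≤ locA`
    have h1 : Wscl i (1 - s) y' * (Wscl i s y' * SupA) ≤ locA := by
      rw [hlocA_eq, mul_add]; exact le_add_of_nonneg_right (mul_nonneg hW1'pos.le hPairA0)
    rw [hW1', hWs', ← mul_assoc, ← Real.rpow_add hy', show s - 1 + -s = (-1 : ℝ) by ring, Real.rpow_neg_one] at h1
    rwa [inv_mul_le_iff₀ hy'] at h1
  have hPairA_le : PairA ≤ (geo9K i).len y' ^ (1 - s) * locA := by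
    have h1 : Wscl i (1 - s) y' * PairA ≤ locA := by
      rw [hlocA_eq, mul_add]; exact le_add_of_nonneg_left (by positivity)
    have h2 : PairA ≤ (Wscl i (1 - s) y')⁻¹ * locA :=
      calc PairA = (Wscl i (1 - s) y')⁻¹ * (Wscl i (1 - s) y' * PairA) := by rw [← mul_assoc, inv_mul_cancel₀ hW1'pos.ne', one_mul]
        _ ≤ (Wscl i (1 - s) y')⁻¹ * locA := mul_le_mul_of_nonneg_left h1 (inv_nonneg.2 hW1'pos.le)
    rwa [hW1'inv] at h2
  -- the source values: `|A q| ≤ SupA` everywhere (`A = 0` off `Δ̃(y′)`)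
  have hAq : ∀ q : XBK κ i, |A q| ≤ SupA := by
    intro q
    by_cases h : NearY i y' (srcY i q)
    · exact ofSup_abs_le (g := toB6 (geo9K i) R₀ H₀) (fun (q : XBK κ i) (y : IBondY i) => NearY i y (srcY i q)) h A
    · rw [hA q h, abs_zero]; exact hSupA0
  have hX : ∀ (f : FBondY i) (ν' : Fin (d + 1)) (c : κ), ‖assembleK b ν' c A f‖ ≤ basisBound39 b * SupA :=
    fun f ν' c => norm_assembleK_le b ν' c A f fun a => hAq (f, ν', a, c)
  -- geometry: a site of `Δ̃(y)` which is (near a site) of `Δ̃(y′)`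
  have hgeo : ∀ w w' : SiteY i, NearY i y w → NearS i w w' → (NearY i y' w ∨ NearY i y' w') →
      lvl i.hN i.D i.hk y' ≤ lvl i.hN i.D i.hk y + 3 ∧ (geo9K i).dist y y' ≤ rσ := by
    intro w w' hw hww h
    have hwin := levY_window_of_nearY i hw
    have hwinS := levY_window_of_nearS i hww
    have hd1 : (geo9K i).dist y (sIK i bI w) ≤ rNear d ℓ + 1 := dist_sIK_le_of_nearY i hβ1 hw
    have hd2 : (geo9K i).dist (sIK i bI w) (sIK i bI w') ≤ ((d : ℝ) + 1) * (((ℓ : ℝ) + 1) + 1) + 2 :=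
      B9Eq340NearPairBlocks.near_dist_carrier_le i hβ1 (B9Eq340ProbeTransferSNY.nearS_supDist i hww)
    have hr0 : 0 ≤ ((d : ℝ) + 1) * (((ℓ : ℝ) + 1) + 1) + 2 := by positivity
    rcases h with h | h
    · have hwin' := levY_window_of_nearY i h
      have hd3 : (geo9K i).dist (sIK i bI w) y' ≤ rNear d ℓ + 1 := by rw [geo9K_dist_comm]; exact dist_sIK_le_of_nearY i hβ1 h
      refine ⟨by omega, ?_⟩
      calc (geo9K i).dist y y' ≤ (geo9K i).dist y (sIK i bI w) + (geo9K i).dist (sIK i bI w) y' := geo9K_dist_triangle i _ _ _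
        _ ≤ rσ := by rw [hrσ]; linarith
    · have hwin' := levY_window_of_nearY i h
      have hd3 : (geo9K i).dist (sIK i bI w') y' ≤ rNear d ℓ + 1 := by rw [geo9K_dist_comm]; exact dist_sIK_le_of_nearY i hβ1 h
      refine ⟨by omega, ?_⟩
      calc (geo9K i).dist y y' ≤ (geo9K i).dist y (sIK i bI w) + (geo9K i).dist (sIK i bI w) y' := geo9K_dist_triangle i _ _ _
        _ ≤ (geo9K i).dist y (sIK i bI w) + ((geo9K i).dist (sIK i bI w) (sIK i bI w') + (geo9K i).dist (sIK i bI w') y') :=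
            add_le_add le_rfl (geo9K_dist_triangle i _ _ _)
        _ ≤ rσ := by rw [hrσ]; linarith
  -- the comparison of the two blocks' weights in the nonzero cases
  have hcmp : lvl i.hN i.D i.hk y' ≤ lvl i.hN i.D i.hk y + 3 → (geo9K i).dist y y' ≤ rσ →
      (geo9K i).len y' ≤ L ^ 3 * E * (geo9K i).len y ∧ (geo9K i).len y' ^ (1 - s) ≤ L ^ 3 * E * (geo9K i).len y ^ (1 - s) := by
    intro hl hd
    have h1 : (geo9K i).len y' ≤ L ^ 3 * (geo9K i).len y := by rw [hLdef]; exact len_le_of_lvl_le i hcf hl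
    have h2 : (geo9K i).len y' ^ (1 - s) ≤ L ^ 3 * (geo9K i).len y ^ (1 - s) := by
      rw [hLdef] at h1 ⊢; exact rpow_le_of_le_mul hy'.le hy.le (by linarith) (by linarith) h1
    have hE1' := hE1 hd
    have hl3 : 0 ≤ L ^ 3 := by positivity
    constructor
    · calc (geo9K i).len y' ≤ L ^ 3 * (geo9K i).len y := h1
        _ = L ^ 3 * 1 * (geo9K i).len y := by ring
        _ ≤ L ^ 3 * E * (geo9K i).len y := mul_le_mul_of_nonneg_right (mul_le_mul_of_nonneg_left hE1' hl3) hy.le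
    · calc (geo9K i).len y' ^ (1 - s) ≤ L ^ 3 * (geo9K i).len y ^ (1 - s) := h2
        _ = L ^ 3 * 1 * (geo9K i).len y ^ (1 - s) := by ring
        _ ≤ L ^ 3 * E * (geo9K i).len y ^ (1 - s) := mul_le_mul_of_nonneg_right (mul_le_mul_of_nonneg_left hE1' hl3) (Real.rpow_nonneg hy.le _)
  -- THE SUP PART
  set M : ℝ := L ^ 3 * E * (geo9K i).len y * locA with hM
  have hlocA0 : 0 ≤ locA := (bHZKP (κ := κ) i b (taxiB i B cfg U₁) (R := R₀) (H := H₀) hs0.le hs1.le).loc_nonneg _ _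
  have hM0 : 0 ≤ M := by positivity
  have hpt : ∀ p : XSK κ i, NearY i y p.1 → |dirSliceK i μ ν A p| ≤ M := by
    rintro ⟨w, μ', a, c⟩ hw
    rw [dirSliceK_apply]
    by_cases hw' : NearY i y' w
    · have hsrc : srcY i ((⟨(chartY i).symm w, μ⟩ : FBondY i), ν, a, c) = w := Equiv.apply_symm_apply _ _
      obtain ⟨hl, hd⟩ := hgeo w w ((id hw : NearY i y w)) (B9CoReadingCoordsHolderSNear.nearS_of_blkOf_eq i rfl) (Or.inl hw')
      have h1 := (hcmp hl hd).1
      calc |A (⟨(chartY i).symm w, μ⟩, ν, a, c)| ≤ SupA := hAq _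
        _ ≤ (geo9K i).len y' * locA := hSupA_le
        _ ≤ L ^ 3 * E * (geo9K i).len y * locA := mul_le_mul_of_nonneg_right h1 hlocA0
    · have hsrc : ¬ NearY i y' (srcY i ((⟨(chartY i).symm w, μ⟩ : FBondY i), ν, a, c)) := by
        rw [show srcY i ((⟨(chartY i).symm w, μ⟩ : FBondY i), ν, a, c) = w from Equiv.apply_symm_apply _ _]; exact hw'
      rw [hA _ hsrc, abs_zero]; exact hM0
  have hsupPart : Wscl i (1 - s) y * (Wscl i s y * (Size.ofSup (toB6 (geo9K i) R₀ H₀) (fun (q : XSK κ i) (y : IBondY i) => NearY i y q.1)).sz y (dirSliceK i μ ν A)) ≤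
      L ^ 3 * E * locA := by
    have h1 : (Size.ofSup (toB6 (geo9K i) R₀ H₀) (fun (q : XSK κ i) (y : IBondY i) => NearY i y q.1)).sz y (dirSliceK i μ ν A) ≤ M :=
      ofSup_sz_le _ hM0 fun q (hq : NearY i y q.1) => hpt q hq
    have hWW : Wscl i (1 - s) y * Wscl i s y = ((geo9K i).len y)⁻¹ := by
      rw [hW1, hWs, ← Real.rpow_add hy, show s - 1 + -s = (-1 : ℝ) by ring, Real.rpow_neg_one]
    calc Wscl i (1 - s) y * (Wscl i s y * _) = (Wscl i (1 - s) y * Wscl i s y) * _ := by ring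
      _ ≤ (Wscl i (1 - s) y * Wscl i s y) * M := mul_le_mul_of_nonneg_left h1 (mul_nonneg (Wscl_nonneg i _ _) (Wscl_nonneg i _ _))
      _ = (((geo9K i).len y)⁻¹ * (geo9K i).len y) * (L ^ 3 * E * locA) := by rw [hWW, hM]; ring
      _ = L ^ 3 * E * locA := by rw [inv_mul_cancel₀ hy.ne', one_mul]
  -- THE PAIR PART
  set Cp : ℝ := L ^ 3 * (1 + 2 * coordBound39 b * basisBound39 b * L ^ 2) with hCp
  have hCp0 : 0 ≤ Cp := by positivity
  set M₂ : ℝ := Cp * E * (geo9K i).len y ^ (1 - s) * locA with hM₂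
  have hM₂0 : 0 ≤ M₂ := by have := Real.rpow_nonneg hy.le (1 - s); positivity
  -- the transported difference through the sup channel
  have htrSup : ∀ (x x' : Site (PV d ℓ i.m i.K hd hL) 0) (a c : κ),
      |trDif b (taxiB i B cfg U₁) (⟨x, μ⟩, ν, a, c) (⟨x', μ⟩, ν, a, c) A| ≤ 2 * coordBound39 b * basisBound39 b * SupA := by
    intro x x' a c
    rw [trDif_apply]
    dsimp only
    have hu : UnitaryLike (taxiB i B cfg U₁ ⟨x, μ⟩ ⟨x', μ⟩) := unitaryLike_parTaxiV hU x x'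
    calc |b.repr (assembleK b ν c A ⟨x, μ⟩ - R (taxiB i B cfg U₁ ⟨x, μ⟩ ⟨x', μ⟩) (assembleK b ν c A ⟨x', μ⟩)) a|
        ≤ coordBound39 b * ‖assembleK b ν c A ⟨x, μ⟩ - R (taxiB i B cfg U₁ ⟨x, μ⟩ ⟨x', μ⟩) (assembleK b ν c A ⟨x', μ⟩)‖ := abs_repr_le b _ a
      _ ≤ coordBound39 b * (‖assembleK b ν c A ⟨x, μ⟩‖ + ‖assembleK b ν c A ⟨x', μ⟩‖) := by
          refine mul_le_mul_of_nonneg_left ((norm_sub_le _ _).trans (add_le_add le_rfl (norm_R_le hu _))) hcb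
      _ ≤ coordBound39 b * (basisBound39 b * SupA + basisBound39 b * SupA) := mul_le_mul_of_nonneg_left (add_le_add (hX _ _ _) (hX _ _ _)) hcb
      _ = 2 * coordBound39 b * basisBound39 b * SupA := by ring
  have hpair : ∀ p p' : XSK κ i, NearY i y p.1 → NearPair i p p' → wEta i s p p' * |trDif b (taxiS i B cfg U₁) p p' (dirSliceK i μ ν A)| ≤ M₂ := by
    rintro ⟨w, μ', a, c⟩ ⟨w', sl⟩ hw hpp
    obtain ⟨hne, hnear, hslot⟩ := hpp
    dsimp only at hne hnear hslot hw
    subst hslot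
    obtain ⟨x, rfl⟩ := (chartY i).surjective w
    obtain ⟨x', rfl⟩ := (chartY i).surjective w'
    have hxx : x ≠ x' := fun h => hne (by rw [h])
    rw [trDif_dirSliceK i b cfg U₁ A x x' μ ν μ' a c, wEta_chartY_eq_wEtaK i s x x' μ ν μ' a c a c]
    -- the non-trivial cases share the weight comparison
    have fin : ∀ {t : ℝ}, (NearY i y' (chartY i x) ∨ NearY i y' (chartY i x')) →
        t ≤ (1 + 2 * coordBound39 b * basisBound39 b * L ^ 2) * (geo9K i).len y' ^ (1 - s) * locA → t ≤ M₂ := by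
      intro t hor ht
      obtain ⟨hl, hd⟩ := hgeo (chartY i x) (chartY i x') hw hnear hor
      have h2 := (hcmp hl hd).2
      refine ht.trans ?_
      rw [hM₂, hCp]
      have h0 : 0 ≤ 1 + 2 * coordBound39 b * basisBound39 b * L ^ 2 := by positivity
      calc (1 + 2 * coordBound39 b * basisBound39 b * L ^ 2) * (geo9K i).len y' ^ (1 - s) * locA
          ≤ (1 + 2 * coordBound39 b * basisBound39 b * L ^ 2) * (L ^ 3 * E * (geo9K i).len y ^ (1 - s)) * locA :=
            mul_le_mul_of_nonneg_right (mul_le_mul_of_nonneg_left h2 h0) hlocA0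
        _ = _ := by ring
    -- admissibility of the bond pair, read from the near condition at `x`
    have hsd : (supDist x x' : ℝ) ≤ (((ℓ + 1 : ℕ) : ℝ)) ^ (blkV1 i.hN i.D (⟨x, μ⟩ : FBondY i)).1.1 := by
      have h1 : (blkV1 i.hN i.D (⟨x, μ⟩ : FBondY i)).1.1 = levY i (chartY i x) := blkV1_level_eq_levY i ((⟨x, μ⟩ : FBondY i), ν, a, c)
      rw [h1, supDist_eq_torusSupNorm i x x', ← neg_sub, torusSupNorm_neg (fun μ => one_le_of_mem (chartY i x).2 μ)]
      exact hnear
    have hsdN : supDist x x' ≤ (ℓ + 1) ^ (blkV1 i.hN i.D (⟨x, μ⟩ : FBondY i)).1.1 := by exact_mod_cast hsd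
    have hnotAdm : ¬ Adm i ⟨x, μ⟩ ⟨x', μ⟩ → (ℓ + 1) ^ levY i (chartY i x') < supDist x x' := by
      intro h
      have h1 : (blkV1 i.hN i.D (⟨x', μ⟩ : FBondY i)).1.1 = levY i (chartY i x') := blkV1_level_eq_levY i ((⟨x', μ⟩ : FBondY i), ν, a, c)
      rw [← h1]
      by_contra hle
      exact h ⟨rfl, hsdN, not_lt.1 hle⟩
    have hw0 : 0 ≤ wEtaK (κ := κ) i s (⟨x, μ⟩, ν, a, c) (⟨x', μ⟩, ν, a, c) := wEtaK_nonneg i s _ _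
    have hlenSup : Wscl i s y' * SupA ≤ (geo9K i).len y' ^ (1 - s) * locA := by
      have h1 : Wscl i (1 - s) y' * (Wscl i s y' * SupA) ≤ locA := by
        rw [hlocA_eq, mul_add]; exact le_add_of_nonneg_right (mul_nonneg hW1'pos.le hPairA0)
      have h2 : Wscl i s y' * SupA ≤ (Wscl i (1 - s) y')⁻¹ * locA :=
        calc Wscl i s y' * SupA = (Wscl i (1 - s) y')⁻¹ * (Wscl i (1 - s) y' * (Wscl i s y' * SupA)) := by
              rw [← mul_assoc, inv_mul_cancel₀ hW1'pos.ne', one_mul]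
          _ ≤ (Wscl i (1 - s) y')⁻¹ * locA := mul_le_mul_of_nonneg_left h1 (inv_nonneg.2 hW1'pos.le)
      rwa [hW1'inv] at h2
    by_cases h1 : NearY i y' (chartY i x)
    · by_cases hadm : Adm i ⟨x, μ⟩ ⟨x', μ⟩
      · -- an admissible pair with first point in `Δ̃(y′)`: a pair of the bond class
        have hP : NearPairK (κ := κ) i (⟨x, μ⟩, ν, a, c) (⟨x', μ⟩, ν, a, c) := nearPairK_of_adm i hxx hadm
        have ht := ofPairsT_term_le (g := toB6 (geo9K i) R₀ H₀) (mem := fun (q : XBK κ i) (y : IBondY i) => NearY i y (srcY i q))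
          (P := NearPairK i) (w := wEtaK i s) (hw := wEtaK_nonneg i s) (Δ := trDif b (taxiB i B cfg U₁)) (y := y') (z := ((⟨x, μ⟩ : FBondY i), ν, a, c))
          (z' := ((⟨x', μ⟩ : FBondY i), ν, a, c)) h1 hP A
        refine fin (Or.inl h1) (ht.trans (hPairA_le.trans ?_))
        have h0 : 0 ≤ (geo9K i).len y' ^ (1 - s) * locA := by have := Real.rpow_nonneg hy'.le (1 - s); positivity
        have hk : (1 : ℝ) ≤ 1 + 2 * coordBound39 b * basisBound39 b * L ^ 2 := le_add_of_nonneg_right (by positivity)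
        rw [mul_assoc]
        exact le_mul_of_one_le_left h0 hk
      · -- a non-admissible near pair: through the sup channel
        have hlt := hnotAdm hadm
        have hj : lvl i.hN i.D i.hk y' ≤ levY i (chartY i x') + 2 := by
          have := (levY_window_of_nearY i h1).1; have := (levY_window_of_nearS i hnear).1; omega
        have hwle := wEtaK_le_of_lt i (κ := κ) hs0.le hs1.le (q := ((⟨x, μ⟩ : FBondY i), ν, a, c)) (q' := ((⟨x', μ⟩ : FBondY i), ν, a, c)) hlt hj
        refine fin (Or.inl h1) ?_
        calc _ ≤ ((((ℓ + 1 : ℕ) : ℝ)) ^ 2 * Wscl i s y') * (2 * coordBound39 b * basisBound39 b * SupA) :=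
              mul_le_mul hwle (htrSup x x' a c) (abs_nonneg _) (by positivity)
          _ = 2 * coordBound39 b * basisBound39 b * L ^ 2 * (Wscl i s y' * SupA) := by rw [hLdef]; ring
          _ ≤ 2 * coordBound39 b * basisBound39 b * L ^ 2 * ((geo9K i).len y' ^ (1 - s) * locA) := mul_le_mul_of_nonneg_left hlenSup (by positivity)
          _ ≤ _ := by
              have h0 : 0 ≤ (geo9K i).len y' ^ (1 - s) * locA := by have := Real.rpow_nonneg hy'.le (1 - s); positivity
              calc 2 * coordBound39 b * basisBound39 b * L ^ 2 * ((geo9K i).len y' ^ (1 - s) * locA)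
                  ≤ (geo9K i).len y' ^ (1 - s) * locA + 2 * coordBound39 b * basisBound39 b * L ^ 2 * ((geo9K i).len y' ^ (1 - s) * locA) :=
                    le_add_of_nonneg_left h0
                _ = _ := by ring
    · by_cases h2 : NearY i y' (chartY i x')
      · -- first point off `Δ̃(y′)`: its assembled value vanishes
        have hX0 : assembleK b ν c A ⟨x, μ⟩ = 0 := by
          unfold assembleK
          refine Finset.sum_eq_zero fun a' _ => ?_
          rw [hA ((⟨x, μ⟩ : FBondY i), ν, a', c) h1, zero_smul]
        by_cases hadm : Adm i ⟨x, μ⟩ ⟨x', μ⟩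
        · -- admissible: the REVERSED pair is a pair of the bond class, every coordinate
          have hadm' : Adm i ⟨x', μ⟩ ⟨x, μ⟩ := by
            obtain ⟨-, ha1, ha2⟩ := hadm
            refine ⟨rfl, ?_, ?_⟩ <;> rw [B3TorusRadialSums.supDist_comm] <;> assumption
          have hP' : ∀ a' : κ, NearPairK (κ := κ) i (⟨x', μ⟩, ν, a', c) (⟨x, μ⟩, ν, a', c) := fun a' => nearPairK_of_adm i hxx.symm hadm'
          set w₀ : ℝ := wEtaK (κ := κ) i s (⟨x', μ⟩, ν, a, c) (⟨x, μ⟩, ν, a, c) with hw₀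
          have hwsymm : wEtaK (κ := κ) i s (⟨x, μ⟩, ν, a, c) (⟨x', μ⟩, ν, a, c) = w₀ := by
            rw [hw₀, wEtaK, wEtaK]; dsimp only; rw [B3TorusRadialSums.supDist_comm]
          have hw₀pos : 0 < w₀ := by
            rw [hw₀, wEtaK]; dsimp only
            have hsd0 : supDist x' x ≠ 0 := fun h => hxx.symm ((B3TorusRadialSums.supDist_eq_zero_iff x' x).1 h)
            have hsd1 : (0 : ℝ) < (supDist x' x : ℝ) := by exact_mod_cast Nat.pos_of_ne_zero hsd0
            have hN : (0 : ℝ) < (nKT (toKT i) : ℝ) := nKT_pos _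
            exact inv_pos.2 (Real.rpow_pos_of_pos (div_pos hsd1 hN) _)
          -- each coordinate of `X′ = assembleK A ⟨x′,μ⟩` is a reversed-pair term divided by the weight
          have hcoord : ∀ a' : κ, |A (⟨x', μ⟩, ν, a', c)| ≤ PairA / w₀ := by
            intro a'
            have ht := ofPairsT_term_le (g := toB6 (geo9K i) R₀ H₀) (mem := fun (q : XBK κ i) (y : IBondY i) => NearY i y (srcY i q))
              (P := NearPairK i) (w := wEtaK i s) (hw := wEtaK_nonneg i s) (Δ := trDif b (taxiB i B cfg U₁)) (y := y') (z := ((⟨x', μ⟩ : FBondY i), ν, a', c))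
              (z' := ((⟨x, μ⟩ : FBondY i), ν, a', c)) h2 (hP' a') A
            rw [trDif_apply] at ht
            dsimp only at ht
            rw [hX0, hR0, sub_zero, repr_assembleK, show wEtaK (κ := κ) i s (⟨x', μ⟩, ν, a', c) (⟨x, μ⟩, ν, a', c) = w₀ from rfl] at ht
            rw [le_div_iff₀ hw₀pos, mul_comm]; exact ht
          have hX' : ‖assembleK b ν c A ⟨x', μ⟩‖ ≤ basisBound39 b * (PairA / w₀) := norm_assembleK_le b ν c A ⟨x', μ⟩ hcoord
          have hu : UnitaryLike (taxiB i B cfg U₁ ⟨x, μ⟩ ⟨x', μ⟩) := unitaryLike_parTaxiV hU x x'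
          refine fin (Or.inr h2) ?_
          rw [trDif_apply]
          dsimp only
          rw [hX0, zero_sub, map_neg, Finsupp.neg_apply, abs_neg, hwsymm]
          calc w₀ * |b.repr (R (taxiB i B cfg U₁ ⟨x, μ⟩ ⟨x', μ⟩) (assembleK b ν c A ⟨x', μ⟩)) a|
              ≤ w₀ * (coordBound39 b * ‖R (taxiB i B cfg U₁ ⟨x, μ⟩ ⟨x', μ⟩) (assembleK b ν c A ⟨x', μ⟩)‖) := mul_le_mul_of_nonneg_left (abs_repr_le b _ a) hw₀pos.le
            _ ≤ w₀ * (coordBound39 b * (basisBound39 b * (PairA / w₀))) :=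
                mul_le_mul_of_nonneg_left (mul_le_mul_of_nonneg_left ((norm_R_le hu _).trans hX') hcb) hw₀pos.le
            _ = coordBound39 b * basisBound39 b * PairA := by field_simp
            _ ≤ coordBound39 b * basisBound39 b * ((geo9K i).len y' ^ (1 - s) * locA) := mul_le_mul_of_nonneg_left hPairA_le (by positivity)
            _ ≤ _ := by
                have h0 : 0 ≤ (geo9K i).len y' ^ (1 - s) * locA := by have := Real.rpow_nonneg hy'.le (1 - s); positivity
                have hL2 : (1 : ℝ) ≤ L ^ 2 := one_le_pow₀ hL1
                have hcc : 0 ≤ coordBound39 b * basisBound39 b := mul_nonneg hcb hbb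
                calc coordBound39 b * basisBound39 b * ((geo9K i).len y' ^ (1 - s) * locA)
                    ≤ coordBound39 b * basisBound39 b * L ^ 2 * ((geo9K i).len y' ^ (1 - s) * locA) := by
                      refine mul_le_mul_of_nonneg_right ?_ h0
                      calc coordBound39 b * basisBound39 b = coordBound39 b * basisBound39 b * 1 := (mul_one _).symm
                        _ ≤ coordBound39 b * basisBound39 b * L ^ 2 := mul_le_mul_of_nonneg_left hL2 hcc
                  _ ≤ (geo9K i).len y' ^ (1 - s) * locA + 2 * (coordBound39 b * basisBound39 b * L ^ 2 * ((geo9K i).len y' ^ (1 - s) * locA)) := by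
                      have h5 : 0 ≤ coordBound39 b * basisBound39 b * L ^ 2 * ((geo9K i).len y' ^ (1 - s) * locA) := by positivity
                      linarith
                  _ = _ := by ring
        · -- non-admissible: through the sup channel at `x′ ∈ Δ̃(y′)`
          have hlt := hnotAdm hadm
          have hj : lvl i.hN i.D i.hk y' ≤ levY i (chartY i x') + 2 := by
            have := (levY_window_of_nearY i h2).1; omega
          have hwle := wEtaK_le_of_lt i (κ := κ) hs0.le hs1.le (q := ((⟨x, μ⟩ : FBondY i), ν, a, c)) (q' := ((⟨x', μ⟩ : FBondY i), ν, a, c)) hlt hj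
          refine fin (Or.inr h2) ?_
          calc _ ≤ ((((ℓ + 1 : ℕ) : ℝ)) ^ 2 * Wscl i s y') * (2 * coordBound39 b * basisBound39 b * SupA) :=
                mul_le_mul hwle (htrSup x x' a c) (abs_nonneg _) (by positivity)
            _ = 2 * coordBound39 b * basisBound39 b * L ^ 2 * (Wscl i s y' * SupA) := by rw [hLdef]; ring
            _ ≤ 2 * coordBound39 b * basisBound39 b * L ^ 2 * ((geo9K i).len y' ^ (1 - s) * locA) := mul_le_mul_of_nonneg_left hlenSup (by positivity)
            _ ≤ _ := by
                have h0 : 0 ≤ (geo9K i).len y' ^ (1 - s) * locA := by have := Real.rpow_nonneg hy'.le (1 - s); positivity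
                calc 2 * coordBound39 b * basisBound39 b * L ^ 2 * ((geo9K i).len y' ^ (1 - s) * locA)
                    ≤ (geo9K i).len y' ^ (1 - s) * locA + 2 * coordBound39 b * basisBound39 b * L ^ 2 * ((geo9K i).len y' ^ (1 - s) * locA) :=
                      le_add_of_nonneg_left h0
                  _ = _ := by ring
      · -- both points off `Δ̃(y′)`: the term vanishes
        have hX0 : assembleK b ν c A ⟨x, μ⟩ = 0 := by
          unfold assembleK
          refine Finset.sum_eq_zero fun a' _ => ?_
          rw [hA ((⟨x, μ⟩ : FBondY i), ν, a', c) h1, zero_smul]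
        have hX0' : assembleK b ν c A ⟨x', μ⟩ = 0 := by
          unfold assembleK
          refine Finset.sum_eq_zero fun a' _ => ?_
          rw [hA ((⟨x', μ⟩ : FBondY i), ν, a', c) h2, zero_smul]
        rw [trDif_apply]
        dsimp only
        rw [hX0, hX0', hR0, sub_zero, map_zero, Finsupp.zero_apply, abs_zero, mul_zero]
        exact hM₂0
  have hpairPart : Wscl i (1 - s) y * (Size.ofPairsT (toB6 (geo9K i) R₀ H₀) (fun (q : XSK κ i) (y : IBondY i) => NearY i y q.1) (NearPair i) (wEta i s)
        (wEta_nonneg i s) (trDif b (taxiS i B cfg U₁))).sz y (dirSliceK i μ ν A) ≤ Cp * E * locA := by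
    have h1 : (Size.ofPairsT (toB6 (geo9K i) R₀ H₀) (fun (q : XSK κ i) (y : IBondY i) => NearY i y q.1) (NearPair i) (wEta i s) (wEta_nonneg i s)
        (trDif b (taxiS i B cfg U₁))).sz y (dirSliceK i μ ν A) ≤ M₂ :=
      ofPairsT_sz_le _ _ _ _ _ hM₂0 fun p p' (hp : NearY i y p.1) (hpp : NearPair i p p') => hpair p p' hp hpp
    calc Wscl i (1 - s) y * _ ≤ Wscl i (1 - s) y * M₂ := mul_le_mul_of_nonneg_left h1 (Wscl_nonneg i _ _)
      _ = (Wscl i (1 - s) y * (geo9K i).len y ^ (1 - s)) * (Cp * E * locA) := by rw [hM₂]; ring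
      _ = Cp * E * locA := by rw [← hW1inv, mul_inv_cancel₀ (ne_of_gt (lt_of_lt_of_le zero_lt_one (one_le_Wscl i (by linarith) y))), one_mul]
  -- assemble
  rw [mul_add]
  refine le_trans (add_le_add hsupPart hpairPart) (le_of_eq ?_)
  rw [hE, hCp]
  ring

end Main

end Literature.MathematicalPhysics.QuantumFieldTheory.Balaban1983to89.B9SmoothHolderClassSliceSN

end
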